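import Summits.QuantumFields.BalabanUV.Beta.D1BFx.FineStencilBFBalaban
import Summits.QuantumFields.BalabanUV.Beta.D1BFx.ReducedKernel

/-!
# `BalabanUV.Beta.D1BFx.GluonKernel` — road «BF-x» for binder row D1, sub-leaf T7-gl: THE GLUON FINE ONE-SHOT KERNEL
# `Pgl n a cE cVH cΛ cR cK cQ W := TOfRed n a (SbfBal n a cE cVH cΛ cR cK cQ) W` — the BF first-order fine stencil at Bałaban's gauge term
# (T4-inst, binder-free) in the reduced dressed kernel shape (T8) over the gluon leg `Ga n a` (T1), for a GENERIC coarse second-order table `W`;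
# block covariance and base point binder-free; (5.10)-shape decay, summable (1.22) integrand and `AbsMoment₂` under the road's two HONEST
# binders — the leg's decay `Decays (Ga n a) C δ` and the table's localisation `VertexFamily₂ W n Cw δ₂`

HONEST DEPENDENCY (page 1, mandatory): continuum YM on T⁴ ⇐ BetaPertH ∧ nine spine estimates (0/9 proved); BetaPertH ⇐ (D1) ∧ (D4) ∧
CAP+tail; G-an2-4 gates asym, D1 and NE2/3/4.  HONEST FRAMING (cell contract, verbatim): «discharging `BetaPertH` makes Bałaban's UV
stability UNCONDITIONAL — a real constructive-QFT result; it is NOT the continuum limit and NOT the Clay problem.»  THIS MODULE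
DISCHARGES NOTHING of the wall: ONE data definition and [folklore] plumbing of LANDED road scaffolding BY NAME — leaf-04's T8
`D1BFx/ReducedKernel` (`TOfRed`, `blockCovariant_TOfRed`-shape via `GluonLeg.blockCovariant_Ga`, `decay510_TOfRed`, `summable_secondMoment_TOfRed`,
`absMoment₂_TOfRed`, `vertexFamily_vertexRed'`), this seat's T4-inst `D1BFx/FineStencilBFBalaban` (`SbfBal`, `exists_biLoc_SbfBal`,
`vertexRed_SbfBal_translate`, `blockCovariant_vertexRed_SbfBal`).  The ghost twin is leaf-04's `D1BFx/GhostKernel` (T7-gh, `Pgh`).  Road scaffolding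
for ONE road to ONE conjunct (D1); 0 wall binders.  NOT D1, NOT `BetaPertH`, NOT continuum, NOT Clay.
ABSOLUTE RULE (cell charter, verbatim): «No internally-minted statement may enter as a cited fact. Every hypothesis is either
kernel-proved in this package or a verbatim quotation of a PUBLISHED theorem with page reference. The manuscript(s) under audit are NOT
citable for their own disputed steps — they are the thing under adjudication; programme-internal (2001/route/tribunal) claims are never
citable.»  Accordingly there is NO `def … : Prop` below, nothing is cited, and no hypothesis of any theorem is a printed statement.

WHY (skeleton `HOME/beta/skeletons/D1-b2b-balaban-beta-d1-p2.md` v1.4 node O3; `TYPER-SPEC-D1BFx.md` §1 T7 «`Pgl n … := ½·tadpole (Ga n a) (Wbf …)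
− ½·bubble (Ga n a) (Sbf …) (Sbf …)` … `AbsMoment₂`-type summability»; `LEAVES-BFx.md` row T7, typer LEAVES v7 «OPEN after T4-inst/T5: T7-gluon `Pgl`»).
With T4-inst in the tree the stencil side of the gluon kernel has NO open binder; the table side (T5's `Wbf`, dressed by T8-tab `tableRedF`) is
not whole yet, so `W` stays GENERIC with its two properties (block covariance `hWt`, localisation `hW`) as explicit hypotheses — exactly T8's
discipline; the leg's exponential decay is B5 Prop. 1.2 content, NOT in the tree (T1's header), so it stays the explicit binder `hGa`.

CONTENT (`d = 4`; `n` = block side, `[NeZero n]`; `0 < a`).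
* §1 [our object] **`Pgl n a cE cVH cΛ cR cK cQ W`**, `Pgl_eq` (= `hessKer (Ga n a) (vertexRed n (SbfBal …)) W`); BINDER-FREE: `blockCovariant_Pgl` (given the
  table covariance `hWt`), `hess_eq_Pgl` (every base point), `exists_vertexFamily_SbfBal_vertexRed` (the dressed gluon vertex is a `VertexFamily`).
* §2 UNDER `hGa : Decays (Ga n a) C δ` (+ table data): `decay510_Pgl` (explicit constant `hessConst 4 4 δ C Cv Cw` at a common rate), `summable_secondMoment_Pgl`,
  `abs_secondMoment_Pgl_le`, and the rate-matched **`absMoment₂_Pgl`** / **`exists_decay510_Pgl`** (vertex data from §1, so the ONLY binders are `hGa`, `hW`).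
NOT HERE: `W := tableRedF n Wbf` (T5), colour/loop weights, the identification with a piece of the wall's one-shot kernel (K-R1/K-R2), any `n`-uniformity
beyond T8's explicit constants.  Unit `b2b-balaban-beta-d1-formalise-leaf-05` (gen 3), D1 formalisation swarm; `LEAVES-BFx.md` sub-row T7-gl.
-/

noncomputable section

namespace Summit.QuantumFields.BalabanUV.Beta.D1BFx.GluonKernel

open Literature.MathematicalPhysics.QuantumFieldTheory.Balaban1983to89
open Literature.MathematicalPhysics.QuantumFieldTheory.Balaban1983to89.Beta
open B12Sec2to5 (l1 Decay510)
open ExpKernelCalculus (Site MKer Decays BiLoc VertexFamily VertexFamily₂ BlockCovariant hess hessKer hess_eq_hessKer shiftK hdec_hessKer)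
open DecimatedMomentSummable (AbsMoment₂)
open HessKerRate (hessConst)
open OneStepResolventKernel (decays_mono biLoc_mono)
open Summit.QuantumFields.BalabanUV.Beta.D1BFx.GluonLeg (Ga)
open Summit.QuantumFields.BalabanUV.Beta.D1BFx.ReducedKernel (TableR vertexRed TOfRed TOfRed_eq decay510_TOfRed summable_secondMoment_TOfRed
  abs_secondMoment_TOfRed_le absMoment₂_TOfRed)
open Summit.QuantumFields.BalabanUV.Beta.D1BFx.FineStencilBFBalaban (SbfBal exists_biLoc_SbfBal exists_vertexFamily_vertexRed_SbfBal
  blockCovariant_vertexRed_SbfBal)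

/-! ## §1 The gluon fine one-shot kernel and its binder-free structure -/

/-- [our object] **T7-gl — THE GLUON FINE ONE-SHOT KERNEL** at block size `n`, averaging weight `a`, real stencil weights `cE cVH cΛ cR cK cQ` and a
coarse second-order table `W`: `Pgl n a … W := TOfRed n a (SbfBal n a cE cVH cΛ cR cK cQ) W` — T4-inst's fine stencil at Bałaban's `U = 1` gauge
term in T8's reduced dressed kernel shape over the gluon leg (T1).  Loop/colour weights are NOT applied.  A DEFINITION; asserts nothing. -/
def Pgl (n : ℕ) [NeZero n] (a cE cVH cΛ cR cK cQ : ℝ) (W : TableR) : Fin 4 → Fin 4 → Site 4 → ℝ :=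
  TOfRed n a (SbfBal n a cE cVH cΛ cR cK cQ) W

variable (n : ℕ) [NeZero n] (a cE cVH cΛ cR cK cQ : ℝ)

/-- [our object] Unfolding `Pgl` down to `hessKer` (`½·tadpole − ½·bubble` over `Ga n a`). -/
theorem Pgl_eq (W : TableR) : Pgl n a cE cVH cΛ cR cK cQ W = hessKer (Ga n a) (vertexRed n (SbfBal n a cE cVH cΛ cR cK cQ)) W := rfl

/-- [folklore] **BLOCK COVARIANCE OF THE GLUON DATA**, binder-free on the leg and stencil sides: for a block-covariant table `W`,
`BlockCovariant (Ga n a) (vertexRed n (SbfBal …)) W n` (T4-inst's plug 3). -/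
theorem blockCovariant_Pgl (ha : 0 < a) {W : TableR}
    (hWt : ∀ (μ : Fin 4) (y : Site 4) (ν : Fin 4) (y' t : Site 4), W μ (y + t) ν (y' + t) = shiftK (-((n : ℤ) • t)) (W μ y ν y')) :
    BlockCovariant (Ga n a) (vertexRed n (SbfBal n a cE cVH cΛ cR cK cQ)) W n :=
  blockCovariant_vertexRed_SbfBal n a ha cE cVH cΛ cR cK cQ hWt

/-- [folklore] **THE BASE POINT IS IMMATERIAL**: `hess (Ga n a) (vertexRed n (SbfBal …)) W μ y ν y′ = Pgl … W μ ν (y′ − y)`. -/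
theorem hess_eq_Pgl (ha : 0 < a) {W : TableR}
    (hWt : ∀ (μ : Fin 4) (y : Site 4) (ν : Fin 4) (y' t : Site 4), W μ (y + t) ν (y' + t) = shiftK (-((n : ℤ) • t)) (W μ y ν y'))
    (μ : Fin 4) (y : Site 4) (ν : Fin 4) (y' : Site 4) :
    hess (Ga n a) (vertexRed n (SbfBal n a cE cVH cΛ cR cK cQ)) W μ y ν y' = Pgl n a cE cVH cΛ cR cK cQ W μ ν (y' - y) :=
  hess_eq_hessKer (blockCovariant_Pgl n a cE cVH cΛ cR cK cQ ha hWt) μ y ν y'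

/-- [folklore] **THE DRESSED GLUON VERTEX IS A VERTEX FAMILY**, binder-free (T4-inst plug 1 by name). -/
theorem exists_vertexFamily_vertexRed (ha : 0 < a) :
    ∃ Cv δv : ℝ, 0 < δv ∧ VertexFamily (vertexRed n (SbfBal n a cE cVH cΛ cR cK cQ)) n Cv δv :=
  exists_vertexFamily_vertexRed_SbfBal n a ha cE cVH cΛ cR cK cQ

/-! ## §2 Under the leg's decay binder: decay, summability and `AbsMoment₂` of every channel -/

section Decay

variable {W : TableR} {C Cv Cw δ : ℝ}

/-- [folklore] **(5.10)-SHAPE DECAY, EXPLICIT CONSTANT** at a common rate `δ`: GIVEN `Decays (Ga n a) C δ` (HONEST BINDER, B5 Prop. 1.2 content,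
not in the tree), a vertex-family bound at rate `δ` and `VertexFamily₂ W n Cw δ`:
`Decay510 (Pgl … W μ ν) (hessConst 4 4 δ C Cv Cw) (δ/4)` (T8's `decay510_TOfRed`). -/
theorem decay510_Pgl (hGa : Decays (Ga n a) C δ) (hV : VertexFamily (vertexRed n (SbfBal n a cE cVH cΛ cR cK cQ)) n Cv δ)
    (hW : VertexFamily₂ W n Cw δ) (hδ : 0 < δ) (μ ν : Fin 4) :
    Decay510 (Pgl n a cE cVH cΛ cR cK cQ W μ ν) (hessConst 4 4 δ C Cv Cw) (δ / 4) :=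
  decay510_TOfRed n a NeZero.one_le hGa hV hW hδ μ ν

/-- [folklore] … hence the (1.22) integrand of every channel is summable … -/
theorem summable_secondMoment_Pgl (hGa : Decays (Ga n a) C δ) (hV : VertexFamily (vertexRed n (SbfBal n a cE cVH cΛ cR cK cQ)) n Cv δ)
    (hW : VertexFamily₂ W n Cw δ) (hδ : 0 < δ) (μ ν : Fin 4) :
    Summable (fun x : Site 4 => Pgl n a cE cVH cΛ cR cK cQ W μ ν x * (x μ : ℝ) * (x ν : ℝ)) :=
  summable_secondMoment_TOfRed n a NeZero.one_le hGa hV hW hδ μ ν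

/-- [folklore] … and bounded by a function of the decay data only. -/
theorem abs_secondMoment_Pgl_le (hGa : Decays (Ga n a) C δ) (hV : VertexFamily (vertexRed n (SbfBal n a cE cVH cΛ cR cK cQ)) n Cv δ)
    (hW : VertexFamily₂ W n Cw δ) (hδ : 0 < δ) (μ ν : Fin 4) :
    |B12Beta.secondMoment (Pgl n a cE cVH cΛ cR cK cQ W) μ ν| ≤ B12Sec2to5.betaPrime510 4 (hessConst 4 4 δ C Cv Cw) (δ / 4) :=
  abs_secondMoment_TOfRed_le n a NeZero.one_le hGa hV hW hδ μ ν

/-- [folklore] **T7-gl: THE GLUON FINE KERNEL IS A WELL-TYPED (1.22)-KERNEL** — `AbsMoment₂ (Pgl … W μ ν)` for every channel, GIVEN ONLY the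
leg's decay `Decays (Ga n a) C δA` (any `δA > 0`) and the table's localisation `VertexFamily₂ W n Cw δ₂` (any `δ₂ > 0`); the stencil side is
binder-free (§1), rates matched by T8's `absMoment₂_TOfRed`. -/
theorem absMoment₂_Pgl (ha : 0 < a) {δA δ2 : ℝ} (hGa : Decays (Ga n a) C δA) (hδA : 0 < δA) (hW : VertexFamily₂ W n Cw δ2)
    (hδ2 : 0 < δ2) (μ ν : Fin 4) : AbsMoment₂ (Pgl n a cE cVH cΛ cR cK cQ W μ ν) := by
  obtain ⟨Cv', δv, hδv, hV⟩ := exists_vertexFamily_vertexRed n a cE cVH cΛ cR cK cQ ha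
  exact absMoment₂_TOfRed n a NeZero.one_le hGa hδA hV hδv hW hδ2 μ ν

/-- [folklore] **(5.10)-SHAPE DECAY OF EVERY CHANNEL, SOME CONSTANT AND RATE**, under the same two binders (`ExpKernelCalculus.hdec_hessKer`,
rates matched by monotonicity). -/
theorem exists_decay510_Pgl (ha : 0 < a) {δA δ2 : ℝ} (hGa : Decays (Ga n a) C δA) (hδA : 0 < δA) (hW : VertexFamily₂ W n Cw δ2)
    (hδ2 : 0 < δ2) : ∃ C' δ' : ℝ, 0 < δ' ∧ ∀ μ ν : Fin 4, Decay510 (Pgl n a cE cVH cΛ cR cK cQ W μ ν) C' δ' := by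
  obtain ⟨Cv', δv, hδv, hV⟩ := exists_vertexFamily_vertexRed n a cE cVH cΛ cR cK cQ ha
  have hC : 0 ≤ C := hGa.nonneg 0
  have hCv : 0 ≤ Cv' := (hV 0 0).nonneg 0
  have hCw : 0 ≤ Cw := (hW 0 0 0 0).nonneg 0
  set δ' : ℝ := min δA (min δv δ2) with hδ'
  have hδ'pos : 0 < δ' := lt_min hδA (lt_min hδv hδ2)
  have hA' : Decays (Ga n a) C δ' := decays_mono hGa hC le_rfl (min_le_left _ _)
  have hV' : VertexFamily (vertexRed n (SbfBal n a cE cVH cΛ cR cK cQ)) n Cv' δ' := fun μ y =>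
    biLoc_mono (hV μ y) hCv ((min_le_right _ _).trans (min_le_left _ _))
  have hW' : VertexFamily₂ W n Cw δ' := fun μ y ν y' =>
    biLoc_mono (hW μ y ν y') hCw ((min_le_right _ _).trans (min_le_right _ _))
  obtain ⟨C', δ'', hδ'', h⟩ := hdec_hessKer hA' hV' hW' hδ'pos (NeZero.one_le (n := n))
  exact ⟨C', δ'', hδ'', fun μ ν => h μ ν⟩

end Decay

end Summit.QuantumFields.BalabanUV.Beta.D1BFx.GluonKernel

end
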